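import Summits.ResolutionOfSingularities.ResolutionOfSingularities.Theorems.FrobeniusLadderFInjectiveMacaulayficationS1FaceConeClause
import Summits.ResolutionOfSingularities.ResolutionOfSingularities.Theorems.FrobeniusLadderFInjectiveMacaulayficationThreefoldIdentities
import Summits.ResolutionOfSingularities.ResolutionOfSingularities.Theorems.FrobeniusLadderFInjectiveMacaulayficationThreefoldNotDvd
import Summits.ResolutionOfSingularities.ResolutionOfSingularities.Theorems.FrobeniusLadderFInjectiveMacaulayficationThreefoldG3Prime
import Summits.ResolutionOfSingularities.ResolutionOfSingularities.Theorems.FrobeniusLadderFInjectiveMacaulayficationPrimeTransfer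
import Summits.ResolutionOfSingularities.ResolutionOfSingularities.Theorems.FrobeniusLadderFInjectiveMacaulayficationThreefoldOffCentreRegular
import Summits.ResolutionOfSingularities.ResolutionOfSingularities.Theorems.FrobeniusLadderFInjectiveMacaulayficationE8WeightedData
import Summits.ResolutionOfSingularities.ResolutionOfSingularities.Theorems.FrobeniusLadderFInjectiveMacaulayficationWeightedConeCore
import Mathlib.RingTheory.MvPolynomial.WeightedHomogeneous
import Mathlib.Algebra.BigOperators.Fin
import HarnessLib
import Summits.ResolutionOfSingularities.ResolutionOfSingularities.Theorems.FrobeniusLadderFInjectiveMacaulayficationFilteredConeFiModel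

/-!
# The frontier threefold S1 as a `(3,3,3,2)`-FILTERED specimen (G6e data), and its model modulo the filtered engine G5♮
# (crux `FInjectiveMacaulayfication`, line `graded-engine` §17, first FILTERED calibration)

Support file for crux stmt-ResolutionOfSingularities-15315 (`FrobeniusLadder.FInjectiveMacaulayfication`), chain w45a,
seat res-L1-w45a-stub-3. [OURS · L1 W4.5a, CRUX-PLAN v4 §4/§5 (G6e); idea-1 r2 `face-rule` prediction P1
`S1WeightedBlowupFiModel`] — NOT a statement of the manuscript; AI-written, weaker than expert review.

S1 = `f = X₀²X₁ + X₁²X₂ + X₂²X₀ + X₀X₃³ + X₁X₂X₃²` in characteristic `2` (stmt-17936; one point blow-up already works,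
p163422) is semi-quasi-homogeneous for `w = (3,3,3,2)` with NON-isolated initial form `F₉ = X₀²X₁ + X₁²X₂ + X₂²X₀ + X₀X₃³`
— outside the graded class, inside idea-1's class `𝒞_face` = plan-1's FILTERED engine G4♮/G5♮ (`L/w45a/FilteredEngineSig.lean`,
§17 proposal, NOT registered at the time of writing). This file supplies every specimen input of G5♮ for S1 and states the
model modulo G5♮ (whose registered signature may still change with lead-1's (A)/(B) decision — then the last theorem is
re-instantiated in one line):

* `s1VeroneseSplitting` — Veronese saturation for `(3,3,3,2)` and `N = 6 = lcm(3,2)` (peel `X₃³`, `Xᵢ²`, `XᵢXⱼ` for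
  `i ≠ j ≤ 2`; the remaining box has weight `≤ 7`);
* `F9_isWeightedHomogeneous` (weight `9`), `tail_isWeightedHomogeneous` (`X₁X₂X₃²`, weight `10`), and the INITIAL-FORM facts
  `weightedHomogeneousComponent_nine` (`= F₉`), `weightedHomogeneousComponent_lt_nine` (`= 0`), `F9_ne_zero`;
* `s1_offOrigin_clause_char2` — `hoff` for `f` (S1 is regular off the origin: `ThreefoldOffCentreRegular`, p-id in the tree);
  `hoff₀` for `F₉` is `S1FaceConeClause.s1FaceConeClause_char2`; primality and `x̄ⱼ ≠ 0` as in `ThreefoldFiModel.forms_prime`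
  (re-derived from the route-independent `ThreefoldIdentities` / `ThreefoldNotDvd` / `ThreefoldG3Prime` / `PrimeTransfer`);
* `s1FilteredFiModel_char2_of_filteredEngine` — the statement of G5♮ `filteredConeFiModel_of_filteredChartClause` (verbatim,
  as a hypothesis) implies: over every field of characteristic `2`, `Spec k[X]/(f)` has a proper birational model with
  Cohen–Macaulay F-injective domain stalks — the `(3,3,3,2)`-weighted blow-up `affineBlowup I₆` (`c = (2,2,2,3)`, `D = 9`),
  idea-1's prediction P1.

All proofs are glue on Mathlib and landed files; no definitions, no named facts. [folklore]
-/

-- single-problem summit: the doubled namespace component is forced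
set_option linter.dupNamespace false

noncomputable section

open CategoryTheory AlgebraicGeometry

namespace Summit.ResolutionOfSingularities.ResolutionOfSingularities.Theorems.FInjectiveMacaulayfication.S1FilteredData

open MvPolynomial
open Summit.ResolutionOfSingularities.ResolutionOfSingularities.Theorems.FInjectiveMacaulayfication

/-! ## Veronese saturation for `(3,3,3,2)`, `N = 6` -/

/-- The `(3,3,3,2)`-weighted degree in coordinates: `weight ![3,3,3,2] a = 3a₀ + 3a₁ + 3a₂ + 2a₃`. [folklore] -/
theorem weight_eq (a : Fin 4 →₀ ℕ) :
    Finsupp.weight (![3, 3, 3, 2] : Fin 4 → ℕ) a = 3 * a 0 + 3 * a 1 + 3 * a 2 + 2 * a 3 := by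
  rw [Finsupp.weight_apply,
    Finsupp.sum_fintype a (fun i c => c • (![3, 3, 3, 2] : Fin 4 → ℕ) i) (fun _ => zero_smul ℕ _),
    Fin.sum_univ_four]
  simp only [smul_eq_mul, Matrix.cons_val_zero, Matrix.cons_val_one, Matrix.cons_val]
  ring

/-- **Coordinate splitting** for `w = (3,3,3,2)`, `N = 6`: peel `X₃³`, `Xᵢ²` or `XᵢXⱼ` (`i ≠ j ≤ 2`), all of weight
exactly `6`; otherwise at most one of `a₀, a₁, a₂` is `1` and `a₃ ≤ 2`, weight `≤ 7`, so `K = 0`. [folklore] -/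
theorem coord_split (K a₀ a₁ a₂ a₃ : ℕ) (h : (K + 1) * 6 ≤ 3 * a₀ + 3 * a₁ + 3 * a₂ + 2 * a₃) :
    ∃ b₀ b₁ b₂ b₃ c₀ c₁ c₂ c₃ : ℕ, a₀ = b₀ + c₀ ∧ a₁ = b₁ + c₁ ∧ a₂ = b₂ + c₂ ∧ a₃ = b₃ + c₃ ∧
      6 ≤ 3 * b₀ + 3 * b₁ + 3 * b₂ + 2 * b₃ ∧ K * 6 ≤ 3 * c₀ + 3 * c₁ + 3 * c₂ + 2 * c₃ := by
  by_cases h₃ : 3 ≤ a₃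
  · exact ⟨0, 0, 0, 3, a₀, a₁, a₂, a₃ - 3, by omega⟩
  by_cases h₀ : 2 ≤ a₀
  · exact ⟨2, 0, 0, 0, a₀ - 2, a₁, a₂, a₃, by omega⟩
  by_cases h₁ : 2 ≤ a₁
  · exact ⟨0, 2, 0, 0, a₀, a₁ - 2, a₂, a₃, by omega⟩
  by_cases h₂ : 2 ≤ a₂
  · exact ⟨0, 0, 2, 0, a₀, a₁, a₂ - 2, a₃, by omega⟩
  by_cases h₀₁ : 1 ≤ a₀ ∧ 1 ≤ a₁
  · exact ⟨1, 1, 0, 0, a₀ - 1, a₁ - 1, a₂, a₃, by omega⟩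
  by_cases h₀₂ : 1 ≤ a₀ ∧ 1 ≤ a₂
  · exact ⟨1, 0, 1, 0, a₀ - 1, a₁, a₂ - 1, a₃, by omega⟩
  by_cases h₁₂ : 1 ≤ a₁ ∧ 1 ≤ a₂
  · exact ⟨0, 1, 1, 0, a₀, a₁ - 1, a₂ - 1, a₃, by omega⟩
  -- the box: weight `≤ 7`, hence `K = 0`
  exact ⟨a₀, a₁, a₂, a₃, 0, 0, 0, 0, by omega⟩

/-- **Exponent-vector splitting** (`coord_split` along `Finsupp.equivFunOnFinite`). [folklore] -/
theorem finsupp_split (K : ℕ) (a : Fin 4 →₀ ℕ)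
    (ha : (K + 1) * 6 ≤ Finsupp.weight (![3, 3, 3, 2] : Fin 4 → ℕ) a) :
    ∃ b c : Fin 4 →₀ ℕ, a = b + c ∧ 6 ≤ Finsupp.weight (![3, 3, 3, 2] : Fin 4 → ℕ) b ∧
      K * 6 ≤ Finsupp.weight (![3, 3, 3, 2] : Fin 4 → ℕ) c := by
  rw [weight_eq] at ha
  obtain ⟨b₀, b₁, b₂, b₃, c₀, c₁, c₂, c₃, e₀, e₁, e₂, e₃, hb, hc⟩ := coord_split K (a 0) (a 1) (a 2) (a 3) ha
  refine ⟨Finsupp.equivFunOnFinite.symm ![b₀, b₁, b₂, b₃], Finsupp.equivFunOnFinite.symm ![c₀, c₁, c₂, c₃],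
    ?_, ?_, ?_⟩
  · ext i
    fin_cases i <;> simp [e₀, e₁, e₂, e₃]
  · rw [weight_eq]
    simpa using hb
  · rw [weight_eq]
    simpa using hc

/-- **VERONESE SATURATION for the weights `(3,3,3,2)` and `N = 6`** (the `hpow` hypothesis of the filtered engine for S1):
every monomial of weighted degree `≥ 6K` lies in `I₆^K`. [folklore] -/
theorem s1VeroneseSplitting : ∀ (k : Type) [Field k] (K : ℕ) (a : Fin 4 →₀ ℕ),
    K * 6 ≤ Finsupp.weight (![3, 3, 3, 2] : Fin 4 → ℕ) a →
    (MvPolynomial.monomial a (1 : k) : MvPolynomial (Fin 4) k) ∈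
      (Ideal.span {m : MvPolynomial (Fin 4) k | ∃ b : Fin 4 →₀ ℕ,
        6 ≤ Finsupp.weight (![3, 3, 3, 2] : Fin 4 → ℕ) b ∧ m = MvPolynomial.monomial b 1}) ^ K := by
  intro k _ K
  induction K with
  | zero =>
    intro a _
    rw [pow_zero, Ideal.one_eq_top]
    exact Submodule.mem_top
  | succ K ih =>
    intro a ha
    obtain ⟨b, c, rfl, hb, hc⟩ := finsupp_split K a ha
    have hmul : (MvPolynomial.monomial (b + c) (1 : k) : MvPolynomial (Fin 4) k) =
        MvPolynomial.monomial b 1 * MvPolynomial.monomial c 1 := by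
      rw [MvPolynomial.monomial_mul, one_mul]
    rw [pow_succ', hmul]
    exact Ideal.mul_mem_mul (Ideal.subset_span ⟨b, hb, rfl⟩) (ih c hc)

/-! ## The initial form of S1 for the weights `(3,3,3,2)` -/

/-- `F₉ = X₀²X₁ + X₁²X₂ + X₂²X₀ + X₀X₃³` is `(3,3,3,2)`-weighted-homogeneous of weight `9`. [folklore] -/
theorem F9_isWeightedHomogeneous (k : Type) [Field k] :
    MvPolynomial.IsWeightedHomogeneous (![3, 3, 3, 2] : Fin 4 → ℕ)
      (X 0 ^ 2 * X 1 + X 1 ^ 2 * X 2 + X 2 ^ 2 * X 0 + X 0 * X 3 ^ 3 : MvPolynomial (Fin 4) k) 9 := by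
  have hX := fun j : Fin 4 => isWeightedHomogeneous_X k (![3, 3, 3, 2] : Fin 4 → ℕ) j
  refine (((?_ : IsWeightedHomogeneous _ _ 9).add ?_).add ?_).add ?_
  · simpa using ((hX 0).pow 2).mul (hX 1)
  · simpa using ((hX 1).pow 2).mul (hX 2)
  · simpa using ((hX 2).pow 2).mul (hX 0)
  · simpa using (hX 0).mul ((hX 3).pow 3)

/-- The tail `X₁X₂X₃²` of S1 is `(3,3,3,2)`-weighted-homogeneous of weight `10`. [folklore] -/
theorem tail_isWeightedHomogeneous (k : Type) [Field k] :
    MvPolynomial.IsWeightedHomogeneous (![3, 3, 3, 2] : Fin 4 → ℕ)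
      (X 1 * X 2 * X 3 ^ 2 : MvPolynomial (Fin 4) k) 10 := by
  have hX := fun j : Fin 4 => isWeightedHomogeneous_X k (![3, 3, 3, 2] : Fin 4 → ℕ) j
  simpa using ((hX 1).mul (hX 2)).mul ((hX 3).pow 2)

/-- **The `(3,3,3,2)`-weight-`9` component of S1 is `F₉`.** [folklore] -/
theorem weightedHomogeneousComponent_nine (k : Type) [Field k] (f : MvPolynomial (Fin 4) k)
    (hf : f = X 0 ^ 2 * X 1 + X 1 ^ 2 * X 2 + X 2 ^ 2 * X 0 + X 0 * X 3 ^ 3 + X 1 * X 2 * X 3 ^ 2) :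
    MvPolynomial.weightedHomogeneousComponent (![3, 3, 3, 2] : Fin 4 → ℕ) 9 f =
      X 0 ^ 2 * X 1 + X 1 ^ 2 * X 2 + X 2 ^ 2 * X 0 + X 0 * X 3 ^ 3 := by
  rw [hf, map_add, (F9_isWeightedHomogeneous k).weightedHomogeneousComponent_same,
    (tail_isWeightedHomogeneous k).weightedHomogeneousComponent_ne 9 (by norm_num), add_zero]

/-- **S1 has `(3,3,3,2)`-order `9`**: all weighted-homogeneous components below `9` vanish. [folklore] -/
theorem weightedHomogeneousComponent_lt_nine (k : Type) [Field k] (f : MvPolynomial (Fin 4) k)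
    (hf : f = X 0 ^ 2 * X 1 + X 1 ^ 2 * X 2 + X 2 ^ 2 * X 0 + X 0 * X 3 ^ 3 + X 1 * X 2 * X 3 ^ 2) :
    ∀ m < 9, MvPolynomial.weightedHomogeneousComponent (![3, 3, 3, 2] : Fin 4 → ℕ) m f = 0 := by
  intro m hm
  rw [hf, map_add, (F9_isWeightedHomogeneous k).weightedHomogeneousComponent_ne m (by omega),
    (tail_isWeightedHomogeneous k).weightedHomogeneousComponent_ne m (by omega), add_zero]

/-- `F₉ ≠ 0` (it takes the value `1` at `(1,1,0,0)`). [folklore] -/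
theorem F9_ne_zero (k : Type) [Field k] :
    (X 0 ^ 2 * X 1 + X 1 ^ 2 * X 2 + X 2 ^ 2 * X 0 + X 0 * X 3 ^ 3 : MvPolynomial (Fin 4) k) ≠ 0 := by
  intro h0
  have h1 := congrArg (MvPolynomial.eval ![(1 : k), 1, 0, 0]) h0
  simp at h1

/-! ## The off-origin clause for S1 itself (`hoff`, characteristic `2`) -/

/-- **S1 is regular off the origin in characteristic `2`, hence satisfies the engines' off-origin clause `hoff`**
(`ThreefoldOffCentreRegular.stub_threefoldOffCentreRegular` + `E8WeightedData.offOrigin_clause_of_regular`). [folklore] -/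
theorem s1_offOrigin_clause_char2 (k : Type) [Field k] [CharP k 2] (f : MvPolynomial (Fin 4) k)
    (hf : f = MvPolynomial.X 0 ^ 2 * MvPolynomial.X 1 + MvPolynomial.X 1 ^ 2 * MvPolynomial.X 2 +
      MvPolynomial.X 2 ^ 2 * MvPolynomial.X 0 + MvPolynomial.X 0 * MvPolynomial.X 3 ^ 3 +
      MvPolynomial.X 1 * MvPolynomial.X 2 * MvPolynomial.X 3 ^ 2) :
    ∀ (Q : Ideal (MvPolynomial (Fin 4) k ⧸ Ideal.span {f})) [Q.IsMaximal],
      (∃ j : Fin 4, Ideal.Quotient.mk (Ideal.span {f}) (MvPolynomial.X j) ∉ Q) →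
      ∀ d : ℕ, ringKrullDim (Localization.AtPrime Q) = d → ∀ s : Fin d → Localization.AtPrime Q,
        (Ideal.span (Set.range s)).radical.IsMaximal →
          RingTheory.Sequence.IsWeaklyRegular (Localization.AtPrime Q) (List.ofFn s) ∧
          ∀ y : Localization.AtPrime Q, (∃ e : ℕ, y ^ 2 ^ e ∈ Ideal.span
            ((fun z : Localization.AtPrime Q => z ^ 2 ^ e) ''
              (Ideal.span (Set.range s) : Set (Localization.AtPrime Q)))) → y ∈ Ideal.span (Set.range s) := by
  haveI : Fact (Nat.Prime 2) := ⟨Nat.prime_two⟩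
  exact E8WeightedData.offOrigin_clause_of_regular 2 k f
    (fun P _ hP => ThreefoldOffCentreRegular.stub_threefoldOffCentreRegular k f hf P hP)

/-! ## The model modulo the filtered engine G5♮ -/

/-- **G6e modulo G5♮ — ONE `(3,3,3,2)`-WEIGHTED BLOW-UP F-INJECTIVIZES S1 IN CHARACTERISTIC `2`, GIVEN THE FILTERED ENGINE**
(idea-1's prediction P1 `S1WeightedBlowupFiModel`; CRUX-PLAN v4 §4/§5 G6e): assuming the statement of plan-1's §17 filtered engine
G5♮ `FilteredEngine.filteredConeFiModel_of_filteredChartClause` (hypothesis `hG5f`, verbatim from `L/w45a/FilteredEngineSig.lean`),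
for every field `k` of characteristic `2` the threefold `Spec k[X₀,…,X₃]/(X₀²X₁ + X₁²X₂ + X₂²X₀ + X₀X₃³ + X₁X₂X₃²)` has a proper
birational model (the weighted blow-up of the origin, weights `(3,3,3,2)`, `affineBlowup I₆`, `c = (2,2,2,3)`, `D = 9`) all of whose
stalks are domains in which every system of parameters is weakly regular and generates a Frobenius closed ideal. Inputs:
`s1VeroneseSplitting`, the initial-form facts, primality by transfer down the `X₃`-chart, `s1_offOrigin_clause_char2` and
`S1FaceConeClause.s1FaceConeClause_char2`. [folklore] -/
theorem s1FilteredFiModel_char2_of_filteredEngine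
    (hG5f : ∀ (p : ℕ) [Fact p.Prime] (k : Type) [Field k] [CharP k p] (n : ℕ) (w : Fin n → ℕ)
      (N D : ℕ) (c : Fin n → ℕ), 0 < N → (∀ v : Fin n, 0 < w v ∧ c v * w v = N) →
      (∀ (K : ℕ) (b : Fin n →₀ ℕ), K * N ≤ Finsupp.weight w b → (MvPolynomial.monomial b (1 : k) : MvPolynomial (Fin n) k) ∈
        (Ideal.span {m : MvPolynomial (Fin n) k | ∃ b : Fin n →₀ ℕ, N ≤ Finsupp.weight w b ∧ m = MvPolynomial.monomial b 1}) ^ K) →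
      ∀ (f f₀ : MvPolynomial (Fin n) k), f₀ = MvPolynomial.weightedHomogeneousComponent w D f →
      (∀ m < D, MvPolynomial.weightedHomogeneousComponent w m f = 0) → f₀ ≠ 0 → (Ideal.span {f}).IsPrime →
      (∀ v : Fin n, Ideal.Quotient.mk (Ideal.span {f}) (MvPolynomial.X v) ≠ 0) →
      (∀ (Q : Ideal (MvPolynomial (Fin n) k ⧸ Ideal.span {f})) [Q.IsMaximal],
        (∃ j : Fin n, Ideal.Quotient.mk (Ideal.span {f}) (MvPolynomial.X j) ∉ Q) →
        ∀ d : ℕ, ringKrullDim (Localization.AtPrime Q) = d → ∀ s : Fin d → Localization.AtPrime Q,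
          (Ideal.span (Set.range s)).radical.IsMaximal →
            RingTheory.Sequence.IsWeaklyRegular (Localization.AtPrime Q) (List.ofFn s) ∧
            ∀ y : Localization.AtPrime Q, (∃ e : ℕ, y ^ p ^ e ∈ Ideal.span
              ((fun z : Localization.AtPrime Q => z ^ p ^ e) ''
                (Ideal.span (Set.range s) : Set (Localization.AtPrime Q)))) → y ∈ Ideal.span (Set.range s)) →
      (∀ (Q : Ideal (MvPolynomial (Fin n) k ⧸ Ideal.span {f₀})) [Q.IsMaximal],
        (∃ j : Fin n, Ideal.Quotient.mk (Ideal.span {f₀}) (MvPolynomial.X j) ∉ Q) →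
        ∀ d : ℕ, ringKrullDim (Localization.AtPrime Q) = d → ∀ s : Fin d → Localization.AtPrime Q,
          (Ideal.span (Set.range s)).radical.IsMaximal →
            RingTheory.Sequence.IsWeaklyRegular (Localization.AtPrime Q) (List.ofFn s) ∧
            ∀ y : Localization.AtPrime Q, (∃ e : ℕ, y ^ p ^ e ∈ Ideal.span
              ((fun z : Localization.AtPrime Q => z ^ p ^ e) ''
                (Ideal.span (Set.range s) : Set (Localization.AtPrime Q)))) → y ∈ Ideal.span (Set.range s)) →
      ∃ (X' : Scheme.{0}) (π : X' ⟶ Spec (.of (MvPolynomial (Fin n) k ⧸ Ideal.span {f}))), IsProper π ∧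
        Literature.AlgebraicGeometry.Resolution.IsBirational π ∧
        ∀ y : X', IsDomain (X'.presheaf.stalk y) ∧ ∀ d : ℕ, ringKrullDim (X'.presheaf.stalk y) = d →
          ∀ s : Fin d → X'.presheaf.stalk y, (Ideal.span (Set.range s)).radical.IsMaximal →
            RingTheory.Sequence.IsWeaklyRegular (X'.presheaf.stalk y) (List.ofFn s) ∧
            ∀ z : X'.presheaf.stalk y, (∃ e : ℕ, z ^ p ^ e ∈
                Ideal.span ((fun w : X'.presheaf.stalk y => w ^ p ^ e) ''
                  (Ideal.span (Set.range s) : Set (X'.presheaf.stalk y)))) →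
              z ∈ Ideal.span (Set.range s)) :
    ∀ (k : Type) [Field k] [CharP k 2] (f : MvPolynomial (Fin 4) k),
      f = MvPolynomial.X 0 ^ 2 * MvPolynomial.X 1 + MvPolynomial.X 1 ^ 2 * MvPolynomial.X 2 +
        MvPolynomial.X 2 ^ 2 * MvPolynomial.X 0 + MvPolynomial.X 0 * MvPolynomial.X 3 ^ 3 +
        MvPolynomial.X 1 * MvPolynomial.X 2 * MvPolynomial.X 3 ^ 2 →
      ∃ (X' : Scheme.{0}) (π : X' ⟶ Spec (.of (MvPolynomial (Fin 4) k ⧸ Ideal.span {f}))), IsProper π ∧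
        Literature.AlgebraicGeometry.Resolution.IsBirational π ∧
        ∀ y : X', IsDomain (X'.presheaf.stalk y) ∧ ∀ d : ℕ, ringKrullDim (X'.presheaf.stalk y) = d →
          ∀ s : Fin d → X'.presheaf.stalk y, (Ideal.span (Set.range s)).radical.IsMaximal →
            RingTheory.Sequence.IsWeaklyRegular (X'.presheaf.stalk y) (List.ofFn s) ∧
            ∀ z : X'.presheaf.stalk y, (∃ e : ℕ, z ^ 2 ^ e ∈
                Ideal.span ((fun w : X'.presheaf.stalk y => w ^ 2 ^ e) ''
                  (Ideal.span (Set.range s) : Set (X'.presheaf.stalk y)))) →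
              z ∈ Ideal.span (Set.range s) := by
  intro k _ _ f hf
  haveI : Fact (Nat.Prime 2) := ⟨Nat.prime_two⟩
  -- `(f)` prime and no variable in `(f)` (as in `ThreefoldFiModel.forms_prime`: transfer down the `X₃`-chart)
  obtain ⟨-, hXf, -, -, -, hθ3, -⟩ :=
    ThreefoldIdentities.stub_threefoldIdentities k f _ _ _ _ hf rfl rfl rfl rfl
  obtain ⟨hfX, -, -, -, hg3X⟩ := ThreefoldNotDvd.stub_threefoldNotDvd k f _ _ _ _ hf rfl rfl rfl rfl
  have hprime : (Ideal.span {f}).IsPrime :=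
    (PrimeTransfer.stub_primeTransfer k 4 3 f _ 3 hθ3 (hfX 3) hg3X).mpr
      (ThreefoldG3Prime.stub_threefoldG3Prime k _ rfl)
  have hXne : ∀ v : Fin 4, Ideal.Quotient.mk (Ideal.span {f}) (MvPolynomial.X v) ≠ 0 :=
    fun v h => hXf v (Ideal.Quotient.eq_zero_iff_mem.mp h)
  exact hG5f 2 k 4 ![3, 3, 3, 2] 6 9 ![2, 2, 2, 3] (by norm_num) (by decide) (s1VeroneseSplitting k) f
    (X 0 ^ 2 * X 1 + X 1 ^ 2 * X 2 + X 2 ^ 2 * X 0 + X 0 * X 3 ^ 3) (weightedHomogeneousComponent_nine k f hf).symm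
    (weightedHomogeneousComponent_lt_nine k f hf) (F9_ne_zero k) hprime hXne (s1_offOrigin_clause_char2 k f hf)
    (S1FaceConeClause.s1FaceConeClause_char2 k _ rfl)

/-- **idea-1's S1 `x²y + y²z + z²x + xw³ + yzw²` IN CHARACTERISTIC 2 IS F-INJECTIVELY MACAULAYFIED BY ONE `(3,3,3,2)`-WEIGHTED
BLOW-UP — UNCONDITIONAL** (G6e; the filtered engine G5♮ `FilteredConeFiModel.filteredConeFiModel` has LANDED): the first specimen of
the programme whose initial form is NOT the whole equation (the `w`-order filtration is honest: `in_w S1 = F9`, tail `yzw²` of weight 10).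
[folklore] -/
theorem s1FilteredFiModel_char2 :
    ∀ (k : Type) [Field k] [CharP k 2] (f : MvPolynomial (Fin 4) k),
      f = MvPolynomial.X 0 ^ 2 * MvPolynomial.X 1 + MvPolynomial.X 1 ^ 2 * MvPolynomial.X 2 +
        MvPolynomial.X 2 ^ 2 * MvPolynomial.X 0 + MvPolynomial.X 0 * MvPolynomial.X 3 ^ 3 +
        MvPolynomial.X 1 * MvPolynomial.X 2 * MvPolynomial.X 3 ^ 2 →
      ∃ (X' : Scheme.{0}) (π : X' ⟶ Spec (.of (MvPolynomial (Fin 4) k ⧸ Ideal.span {f}))), IsProper π ∧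
        Literature.AlgebraicGeometry.Resolution.IsBirational π ∧
        ∀ y : X', IsDomain (X'.presheaf.stalk y) ∧ ∀ d : ℕ, ringKrullDim (X'.presheaf.stalk y) = d →
          ∀ s : Fin d → X'.presheaf.stalk y, (Ideal.span (Set.range s)).radical.IsMaximal →
            RingTheory.Sequence.IsWeaklyRegular (X'.presheaf.stalk y) (List.ofFn s) ∧
            ∀ z : X'.presheaf.stalk y, (∃ e : ℕ, z ^ 2 ^ e ∈
                Ideal.span ((fun w : X'.presheaf.stalk y => w ^ 2 ^ e) ''
                  (Ideal.span (Set.range s) : Set (X'.presheaf.stalk y)))) →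
              z ∈ Ideal.span (Set.range s) :=
  s1FilteredFiModel_char2_of_filteredEngine FilteredConeFiModel.filteredConeFiModel

end Summit.ResolutionOfSingularities.ResolutionOfSingularities.Theorems.FInjectiveMacaulayfication.S1FilteredData

end
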